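import Mathlib
import HarnessLib
import Literature.MathematicalPhysics.StatisticalMechanics.RenormalisationMapRemaindersOneQ

/-!
# The single-block DEFECT of `K_{k+1}` with a free intermediate Hamiltonian ([ABKM19] Ch. 9.1 / Lemma 9.3):
# `‖Σ_{B̄ = U} p_B(H̃)·(e^{−H₁(B)} − e^{−H₂(B)})‖_{k+1,U} ≤ |U|_k κ^{|U|_k} · 16e^{3/8}‖H₁ − H₂‖_{k,0}`

In the free-`H̃` decomposition of the [ABKM19] map
(`RenormalisationMapDecompositionFreeHt.nextK_freeHt_eq_blockPart_add_remainders_abkm_of_stepKernelBounds`),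
`nextK(μ_D; e^{−H}, e^{−H̃}, K)(U) = blockPart + Σ₁(H̃) + Σ₂ᴸ(H̃) + Σ₃(H̃) + Σ₄(H̃) + Σ₀(H̃)`, the only term that is
not one of the Theorem-6.8 pieces is the single-block defect
`Σ₀(H̃)(U, φ) = Σ_{B ∈ 𝓑_k, B̄ = U} p_B(H̃)(φ)·(e^{−H_{k+1}(B,φ)} − e^{−H̃(B,φ)})`,
`p_B(H̃) = (e^{−H̃})^{U∖B}(e^{H̃})^{B∖U}`.  This file bounds the slightly more general functional
`Σ_B p_B(H̃)·(e^{−H₁(B)} − e^{−H₂(B)})` (two arbitrary Hamiltonians in the exponent; `H₁ = H_{k+1}`, `H₂ = H̃`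
is the defect itself, `H₁ = H̃^{(a)}_{k+1}`, `H₂ = H̃^{(b)}_{k+1}` at a common `H̃` is the two-kernel defect twin)
in the `T_{k+1}^{U*}`-gauge with the weight `w_{k+1}^U` of the torus tower: by the abstract slot lemma
`tayNormLE_subsum_reblockTerm_sub_abkm_slot` (inner family `{∅}`, equal prefactor Hamiltonians) and the
strong-norm Lipschitz bound of the exponential `‖e^{−H₁(B)} − e^{−H₂(B)}‖_{T_k, W_k^B} ≤ 16e^{3/8}‖H₁ − H₂‖_{k,0}`
(Lemma 9.3 (9.13), `StrongNormExpLipschitz`), `W_k^B ≤ w_k^B ≤ w_{k:k+1}^B`.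

* `tayNormLE_blockDefect_sub_abkm` — for a `(k+1)`-polymer `U`, step data with `D.s = L^k`, `D.L = L`,
  `‖H̃‖_{k,0} ≤ τ ≤ 1/16`, `‖H₁‖_{k,0}, ‖H₂‖_{k,0} ≤ 1/16` and a letter `κ ≥ 1 + e^{1/4}`:
  `‖Σ_B p_B(H̃)(e^{−H₁(B)} − e^{−H₂(B)})‖_{T_{k+1}^{U*}, w_{k+1}^U} ≤ |U|_k · κ^{|U|_k} · 16e^{3/8}‖H₁ − H₂‖_{k,0}`
  (the sum is empty unless `U` is a single `(k+1)`-block, `|U|_k = L^d`).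

Everything is proved; no named fact.  Use (honest scope): the free-`H̃` uniform bound (U1) and the free-`H̃`
kernel pair (U2) behind blocks B1–B3 of the stub `stub_f4l2ShrinkLoc` of the rung route
`Summits/HubbardSuperconductivity/…/Theses/ComplexGFFStiffness` (stiffness of a complex Gaussian gradient field via
the [ABKM19] RG); nothing about superconductivity in the Hubbard model is claimed or advanced.

## References
* S. Adams, S. Buchholz, R. Kotecký, S. Müller, arXiv:1910.13564 — Definition 6.5 (6.34), Theorem 6.8, Ch. 9.1,
  Lemma 9.3 (9.11)–(9.13), Lemma 8.3, Theorem 7.1 [AdamsBuchholzKoteckyMuller2019].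
-/

noncomputable section

namespace Literature.MathematicalPhysics.StatisticalMechanics.GradientRG

open scoped BigOperators Classical
open Finset Matrix MeasureTheory
open Literature.MathematicalPhysics.StatisticalMechanics.TorusPolymer
  (IsPolymer blocks polys bprod blockOf thicken reblock boxCorner mem_polys mem_blocks numBlocks isPolymer_blockOf
    card_blocks_eq_numBlocks blocks_blockOf empty_mem_polys reblock_empty subset_thicken
    bprod_empty blocks_empty blocks_mono add_pow_sub_pow_le closure)
open Literature.Barriers.CriticalPhenomena.LongRangePhi4.Polymer (IsConn components)
open Literature.MathematicalPhysics.QuantumFieldTheory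

variable {d M : ℕ} [NeZero M]

set_option maxHeartbeats 800000 in
/-- **The single-block defect bound** (module docstring): `d ≥ 3`, `L` odd, `L ≥ 2^{d+3}+16R`, `R ≥ 2`, `M = L^N`,
`k+1 ≤ N`, `⌊d/2⌋+1 ≤ min(p, M_ord)`, the [ABKM19] weight bounds with `h² ≥ h₀²`; `D.s = L^k`, `D.L = L`; `U` a
`(k+1)`-polymer; `‖H̃‖_{k,0} ≤ τ ≤ 1/16`, `‖H₁‖_{k,0}, ‖H₂‖_{k,0} ≤ 1/16`; `1 + e^{1/4} ≤ κ`.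
[cite: AdamsBuchholzKoteckyMuller2019, Lemma 9.3 (9.13) / Theorem 6.8 / Ch. 9.1] -/
theorem tayNormLE_blockDefect_sub_abkm {L N Mord R n p r₀ : ℕ} {θbar lam μ δ₁ δ₀ A𝒫 h A : ℝ}
    {𝒞 : ℕ → (Fin d → ZMod M) → ℝ} (hd : 3 ≤ d) (hLodd : Odd L) (hL : 2 ^ (d + 3) + 16 * R ≤ L)
    (hR2 : 2 ≤ R) (hM : M = L ^ N) {k : ℕ} (hkN : k + 1 ≤ N) (hp : d / 2 + 1 ≤ p) (hMord : d / 2 + 1 ≤ Mord)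
    (hB : AbkmWeightBounds L N Mord R n θbar lam μ δ₁ δ₀ A𝒫 𝒞
      (abkmWeightData L N Mord R θbar (schedDelta δ₀ δ₁ N) 𝒞))
    (hδ₀ : 0 < δ₀) (hδ₁ : 0 < δ₁) (hh : 0 < h) (hh0 : hZeroSq d R δ₀ δ₁ ≤ h ^ 2)
    (D : StepData d M) (hDs : D.s = L ^ k) (hDL : D.L = L)
    {U : Finset (Fin d → ZMod M)} (hU : IsPolymer (L ^ (k + 1)) U)
    {Ht H₁ H₂ : RelevantHamiltonian ℂ d} {τ : ℝ}
    (hHt : hamNorm (fieldWt h (L : ℝ) d k) ((L : ℝ) ^ k) (L ^ (d * k)) Ht ≤ τ) (hτ : τ ≤ 1 / 16)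
    (hH₁ : hamNorm (fieldWt h (L : ℝ) d k) ((L : ℝ) ^ k) (L ^ (d * k)) H₁ ≤ 1 / 16)
    (hH₂ : hamNorm (fieldWt h (L : ℝ) d k) ((L : ℝ) ^ k) (L ^ (d * k)) H₂ ≤ 1 / 16)
    {κ : ℝ} (hκ : 1 + Real.exp (1 / 4) ≤ κ) :
    TayNormLE ((abkmNormParams L N Mord R p r₀ h θbar A (schedDelta δ₀ δ₁ N) 𝒞).gauge (k + 1) U) r₀
      ((abkmWeightData L N Mord R θbar (schedDelta δ₀ δ₁ N) 𝒞).weight (k + 1) U)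
      (fun φ => ∑ B ∈ blockPartIndex D U,
        bprod (L ^ k) (fun B' => expNegH Ht B' φ) (U \ B) *
            bprod (L ^ k) (fun B' => expNegH (-Ht) B' φ) (B \ U) *
          (expNegH H₁ B φ - expNegH H₂ B φ))
      ((blocks (L ^ k) U).card * κ ^ (blocks (L ^ k) U).card *
        (16 * Real.exp (3 / 8) *
          hamNorm (fieldWt h (L : ℝ) d k) ((L : ℝ) ^ k) (L ^ (d * k)) (H₁ - H₂))) := by
  set P := abkmNormParams L N Mord R p r₀ h θbar A (schedDelta δ₀ δ₁ N) 𝒞 with hP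
  set W := abkmWeightData L N Mord R θbar (schedDelta δ₀ δ₁ N) 𝒞 with hW
  set ρ₀ := 16 * Real.exp (3 / 8) *
    hamNorm (fieldWt h (L : ℝ) d k) ((L : ℝ) ^ k) (L ^ (d * k)) (H₁ - H₂) with hρ₀
  set Δt := 16 * Real.exp (3 / 8) * hamNorm (fieldWt h (L : ℝ) d k) ((L : ℝ) ^ k) (L ^ (d * k)) (Ht - Ht) with hΔt
  set 𝓧' := blockPartIndex D U with h𝓧'def
  -- sizes and basic facts
  have hd2 : 2 ≤ d := by omega
  have hL0 : (0 : ℝ) < L := by exact_mod_cast hLodd.pos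
  have hk : k ≤ N := by omega
  have hMo : Odd M := by rw [hM]; exact hLodd.pow
  have hsodd : Odd (L ^ k) := hLodd.pow
  obtain ⟨t, ht⟩ : ∃ t, N = k + t := ⟨N - k, by omega⟩
  have hMt : M = L ^ k * L ^ t := by rw [← pow_add, ← ht]; exact hM
  have htodd : Odd (L ^ t) := hLodd.pow
  have h𝔥 : 0 < fieldWt h (L : ℝ) d k := fieldWt_pos hh hL0 d k
  have hRk : (0 : ℝ) < (L : ℝ) ^ k := by positivity
  have hnn : ∀ G : RelevantHamiltonian ℂ d, 0 ≤ hamNorm (fieldWt h (L : ℝ) d k) ((L : ℝ) ^ k) (L ^ (d * k)) G :=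
    fun G => hamNorm_nonneg h𝔥.le hRk.le _ _
  have hΔ0 : hamNorm (fieldWt h (L : ℝ) d k) ((L : ℝ) ^ k) (L ^ (d * k)) (Ht - Ht) = 0 := by
    rw [sub_self, hamNorm_zero]
  have hτ0 : 0 ≤ τ := (hnn Ht).trans hHt
  have hρ₀0 : 0 ≤ ρ₀ := by have := hnn (H₁ - H₂); positivity
  have hΔt0 : 0 ≤ Δt := by have := hnn (Ht - Ht); positivity
  have ha0 : 0 ≤ Real.exp (1 / 4) := (Real.exp_pos _).le
  -- the index set: single blocks inside `U`
  have h𝓧' : 𝓧' ⊆ (polys (L ^ k) univ).filter (fun X => reblock (L ^ k) (L * L ^ k) X = U) := by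
    have h := filter_reblock_isConn_card_eq_one D hMo (by rw [hDs]; exact hsodd) (by rw [hDL]; exact hLodd) U
    rw [hDs, hDL] at h
    rw [h𝓧'def, ← h]
    exact filter_subset _ _
  have hblk : ∀ X ∈ 𝓧', ∃ y, X = blockOf (L ^ k) y := fun X hX => by
    have h := blockPartIndex_subset_blocks D U hX
    rw [hDs] at h
    obtain ⟨y, -, rfl⟩ := mem_blocks.1 h
    exact ⟨y, rfl⟩
  have hXU : ∀ X ∈ 𝓧', X ⊆ U := fun X hX => by
    have h := blockPartIndex_subset_blocks D U hX
    rw [hDs] at h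
    obtain ⟨y, hy, rfl⟩ := mem_blocks.1 h
    have hUk : IsPolymer (L ^ k) U := by
      have : IsPolymer (L * L ^ k) U := by rw [show L * L ^ k = L ^ (k + 1) by rw [pow_succ']]; exact hU
      exact this.of_mul hsodd hLodd
    exact hUk y hy
  have hcard𝓧' : (𝓧'.card : ℝ) ≤ (blocks (L ^ k) U).card := by
    have h := blockPartIndex_subset_blocks D U
    rw [hDs] at h
    exact_mod_cast card_le_card h
  have h𝓨 : ∀ X ∈ 𝓧', ({∅} : Finset (Finset (Fin d → ZMod M))) ⊆ polys (L ^ k) X := fun X _ => by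
    intro X₁ hX₁; rw [mem_singleton.1 hX₁]; exact empty_mem_polys _ _
  -- one-block facts for the slot: gauge, weights, norms at `|B| = L^{dk}`
  have hcard : ∀ y : Fin d → ZMod M, (blockOf (L ^ k) y : Finset (Fin d → ZMod M)).card = L ^ (d * k) := fun y => by
    rw [TorusPolymer.card_blockOf hMt hLodd.pow htodd y, ← pow_mul, mul_comm]
  have hgauge : ∀ y : Fin d → ZMod M, P.gauge k (blockOf (L ^ k) y) =
      fieldGauge (fieldWt h (L : ℝ) d k) ((L : ℝ) ^ k) p (thicken (P.rad k) (blockOf (L ^ k) y)) := fun _ => rfl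
  have hSW : ∀ (y : Fin d → ZMod M) ψ, expWeight (strongCoef h N k • derivForm (L : ℝ) k (diffIndex d Mord)
      (boxDensity (boxRad R L k) (boxWt (L : ℝ) d k) (blockOf (L ^ k) y))) ψ ≤ W.midWeight k (blockOf (L ^ k) y) ψ :=
    fun y ψ => (strongWeight_le_weight_abkm hB hδ₀ hδ₁ hh hh0 k (subset_refl _) ψ).trans
      (WeightData.weight_le_midWeight hB.dominated k _ ψ)
  have hexp_d : ∀ (G : RelevantHamiltonian ℂ d) (B : Finset (Fin d → ZMod M)), ContDiff ℝ r₀ (expNegH G B) := by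
    intro G B
    show ContDiff ℝ r₀ (fun φ : (Fin d → ZMod M) → ℝ => Complex.exp (-(eval G B φ)))
    exact (contDiff_eval G _ (n := r₀)).neg.cexp
  have hexp_loc : ∀ (G : RelevantHamiltonian ℂ d) (y : Fin d → ZMod M),
      IsGaugeLocal (P.gauge k (blockOf (L ^ k) y)) (expNegH G (blockOf (L ^ k) y)) := by
    intro G y
    have hBS : blockOf (L ^ k) y ⊆ thicken (P.rad k) (blockOf (L ^ k) y) := subset_thicken _ _
    have hev : IsGaugeLocal (P.gauge k (blockOf (L ^ k) y))
        (fun φ : (Fin d → ZMod M) → ℝ => eval G (blockOf (L ^ k) y) φ) := by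
      rw [hgauge]; exact isGaugeLocal_eval h𝔥.ne' hRk.ne' hp hBS G
    exact fun φ ψ hT => by simp only [expNegH, hev φ ψ hT]
  -- the slot lemma with the inner family `{∅}` and equal prefactor Hamiltonians
  have h2 := tayNormLE_subsum_reblockTerm_sub_abkm_slot (n := n) (lam := lam) (μ := μ) (θbar := θbar) (p := p) (r₀ := r₀)
    (A := A) hd hLodd hL hR2
    hM hkN hp hMord hB hδ₀ hδ₁ hh hh0 hU h𝓧' (𝓨 := fun _ => ({∅} : Finset (Finset (Fin d → ZMod M)))) h𝓨
    hHt hHt hτ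
    (Gs := fun X φ => expNegH H₁ X φ) (Gs' := fun X φ => expNegH H₂ X φ)
    (g := fun _ => Real.exp (1 / 4)) (ρ := fun _ => ρ₀)
    (fun X hX X₁ hX₁ => by
      rw [mem_singleton.1 hX₁, sdiff_empty]
      obtain ⟨y, rfl⟩ := hblk X hX
      have hBS : blockOf (L ^ k) y ⊆ thicken (P.rad k) (blockOf (L ^ k) y) := subset_thicken _ _
      have hH8 : hamNorm (fieldWt h (L : ℝ) d k) ((L : ℝ) ^ k) (blockOf (L ^ k) y).card H₁ ≤ 1 / 8 := by
        rw [hcard y]; exact hH₁.trans (by norm_num)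
      have hs := tayNormLE_expNegH_strong_abkm (R := R) (Mord := Mord) hd2 hLodd hM hk hh hMord hp hBS r₀ hH8
      rw [← hgauge y] at hs
      exact hs.mono_weight ha0 (hSW y))
    (fun X hX X₁ hX₁ => by
      rw [mem_singleton.1 hX₁, sdiff_empty]
      obtain ⟨y, rfl⟩ := hblk X hX
      have hBS : blockOf (L ^ k) y ⊆ thicken (P.rad k) (blockOf (L ^ k) y) := subset_thicken _ _
      have hH₁' : hamNorm (fieldWt h (L : ℝ) d k) ((L : ℝ) ^ k) (blockOf (L ^ k) y).card H₁ ≤ 1 / 16 := by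
        rw [hcard y]; exact hH₁
      have hH₂' : hamNorm (fieldWt h (L : ℝ) d k) ((L : ℝ) ^ k) (blockOf (L ^ k) y).card H₂ ≤ 1 / 16 := by
        rw [hcard y]; exact hH₂
      have hs := tayNormLE_expNegH_sub_strong_abkm (R := R) (Mord := Mord) hd2 hLodd hM hk hh hMord hp hBS r₀ hH₁' hH₂'
      rw [← hgauge y, hcard y] at hs
      exact hs.mono_weight hρ₀0 (hSW y))
    (fun X hX X₁ hX₁ => by rw [mem_singleton.1 hX₁, sdiff_empty]; exact hexp_d H₁ X)
    (fun X hX X₁ hX₁ => by rw [mem_singleton.1 hX₁, sdiff_empty]; exact hexp_d H₂ X)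
    (fun X hX X₁ hX₁ => by
      rw [mem_singleton.1 hX₁, sdiff_empty]
      obtain ⟨y, rfl⟩ := hblk X hX
      exact hexp_loc H₁ y)
    (fun X hX X₁ hX₁ => by
      rw [mem_singleton.1 hX₁, sdiff_empty]
      obtain ⟨y, rfl⟩ := hblk X hX
      exact hexp_loc H₂ y)
    (fun _ _ _ _ => ha0) (fun _ _ _ _ => hρ₀0)
  -- identify the function and bound the constant
  intro φ
  have key := h2 φ
  refine le_trans (le_of_eq_of_le ?_ key) (mul_le_mul_of_nonneg_right ?_ (W.weight_pos (k + 1) U φ).le)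
  · -- the function
    congr 1
    funext ψ
    refine sum_congr rfl fun X hX => ?_
    rw [sum_singleton]
    simp only [sdiff_empty, bprod_empty, one_mul]
    ring
  · -- the constant: every summand `(X, ∅)` is at most `κ^{|U|_k}(Δt e^{1/4} + ρ₀)`, and `Δt = 0`
    clear key h2
    have hκ1 : 1 ≤ κ := by linarith [hκ, Real.exp_pos (1 / 4)]
    have hm : ∀ X ∈ 𝓧', (blocks (L ^ k) (U \ X)).card ≤ (blocks (L ^ k) U).card := fun X _ =>
      card_le_card (blocks_mono _ sdiff_subset)
    have hS : ∀ X ∈ 𝓧', ∀ X₁ ∈ ({∅} : Finset (Finset (Fin d → ZMod M))), ∀ (δ g ρ : ℝ), 0 ≤ δ → 0 ≤ g → 0 ≤ ρ →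
        1 + Real.exp (1 / 4) + δ ≤ κ →
        (((∏ _B ∈ blocks (L ^ k) (U \ X), (Real.exp (1 / 4) + δ)) - ∏ _B ∈ blocks (L ^ k) (U \ X), Real.exp (1 / 4)) *
            (∏ _B ∈ blocks (L ^ k) (X \ U), Real.exp (1 / 4)) *
            ((∏ _B ∈ blocks (L ^ k) X₁, 8 * Real.exp (1 / 4) * τ) * g) +
          (∏ _B ∈ blocks (L ^ k) (U \ X), Real.exp (1 / 4)) *
            ((∏ _B ∈ blocks (L ^ k) (X \ U), (Real.exp (1 / 4) + δ)) - ∏ _B ∈ blocks (L ^ k) (X \ U), Real.exp (1 / 4)) *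
            ((∏ _B ∈ blocks (L ^ k) X₁, 8 * Real.exp (1 / 4) * τ) * g) +
          (∏ _B ∈ blocks (L ^ k) (U \ X), Real.exp (1 / 4)) * (∏ _B ∈ blocks (L ^ k) (X \ U), Real.exp (1 / 4)) *
            (((∏ _B ∈ blocks (L ^ k) X₁, (8 * Real.exp (1 / 4) * τ + δ)) -
              ∏ _B ∈ blocks (L ^ k) X₁, 8 * Real.exp (1 / 4) * τ) * g) +
          (∏ _B ∈ blocks (L ^ k) (U \ X), Real.exp (1 / 4)) * (∏ _B ∈ blocks (L ^ k) (X \ U), Real.exp (1 / 4)) *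
            ((∏ _B ∈ blocks (L ^ k) X₁, 8 * Real.exp (1 / 4) * τ) * ρ)) ≤
          κ ^ (blocks (L ^ k) U).card * (δ * g + ρ) := by
      intro X hX X₁ hX₁ δ g ρ hδ hg hρ hκδ
      have e1 := mem_singleton.1 hX₁
      subst e1
      have hXU0 : X \ U = ∅ := sdiff_eq_empty_iff_subset.2 (hXU X hX)
      rw [hXU0]
      simp only [blocks_empty, prod_empty]
      have hn := hm X hX
      have hκa : Real.exp (1 / 4) ≤ κ := by linarith
      have he : (∏ _B ∈ blocks (L ^ k) (U \ X), (Real.exp (1 / 4) + δ)) - ∏ _B ∈ blocks (L ^ k) (U \ X), Real.exp (1 / 4) ≤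
          δ * κ ^ (blocks (L ^ k) U).card := by
        rw [prod_const, prod_const]
        refine (add_pow_sub_pow_le ha0 hδ _).trans (mul_le_mul_of_nonneg_left ?_ hδ)
        exact (pow_le_pow_left₀ (by positivity) hκδ _).trans (pow_le_pow_right₀ hκ1 hn)
      have ha : ∏ _B ∈ blocks (L ^ k) (U \ X), Real.exp (1 / 4) ≤ κ ^ (blocks (L ^ k) U).card := by
        rw [prod_const]
        exact (pow_le_pow_left₀ ha0 hκa _).trans (pow_le_pow_right₀ hκ1 hn)
      have key : ((∏ _B ∈ blocks (L ^ k) (U \ X), (Real.exp (1 / 4) + δ)) - ∏ _B ∈ blocks (L ^ k) (U \ X), Real.exp (1 / 4)) * g +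
          (∏ _B ∈ blocks (L ^ k) (U \ X), Real.exp (1 / 4)) * ρ ≤ κ ^ (blocks (L ^ k) U).card * (δ * g + ρ) := by
        calc _ ≤ δ * κ ^ (blocks (L ^ k) U).card * g + κ ^ (blocks (L ^ k) U).card * ρ :=
              add_le_add (mul_le_mul_of_nonneg_right he hg) (mul_le_mul_of_nonneg_right ha hρ)
          _ = κ ^ (blocks (L ^ k) U).card * (δ * g + ρ) := by ring
      linarith [key]
    have hκΔt : 1 + Real.exp (1 / 4) + Δt ≤ κ := by
      rw [hΔt, hΔ0, mul_zero, add_zero]; exact hκ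
    have hκm : 0 ≤ κ ^ (blocks (L ^ k) U).card := by positivity
    have hb := sum_le_sum fun X hX => sum_le_sum fun X₁ hX₁ => hS X hX X₁ hX₁ Δt (Real.exp (1 / 4)) ρ₀ hΔt0 ha0 hρ₀0 hκΔt
    refine hb.trans ?_
    simp only [sum_singleton]
    simp only [sum_const, nsmul_eq_mul]
    have hΔt00 : Δt = 0 := by rw [hΔt, hΔ0, mul_zero]
    rw [hΔt00, zero_mul, zero_add]
    have hc0 : (0 : ℝ) ≤ 𝓧'.card := Nat.cast_nonneg _
    calc (𝓧'.card : ℝ) * (κ ^ (blocks (L ^ k) U).card * ρ₀)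
        ≤ ((blocks (L ^ k) U).card : ℝ) * (κ ^ (blocks (L ^ k) U).card * ρ₀) :=
          mul_le_mul_of_nonneg_right hcard𝓧' (mul_nonneg hκm hρ₀0)
      _ = (blocks (L ^ k) U).card * κ ^ (blocks (L ^ k) U).card * ρ₀ := by ring

end Literature.MathematicalPhysics.StatisticalMechanics.GradientRG

end
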